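import Summits.ValiantsHypothesis.ValiantsHypothesis.Theorems.DefinabilityGapPhaseAExists
import HarnessLib

/-!
# Definability gap, ROAD P: Phase A as a reusable interface — the bad set and its weight

`DefinabilityGapPhaseAExists.exists_adm_phaseA` hard-wires the four event families and returns
only an existence statement.  The alteration stages (PLAN-N1-v2 §(5)) add further events (a
Markov bound on the number of movers, per-line collision loads) to the SAME product space, so
this file exposes the interface they need:

* `phaseABad` — the union of the four Phase-A event families, as a `Finset` of row
  assignments (general weight parameters);
* **`weight_phaseABad_le`** — its product weight is at most the sum of the four union bounds;
* **`phaseA_of_not_mem`** — the deterministic read-off: any `r ∉ phaseABad …` has few bad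
  lines (given the budget) and `B` free positions on every line with `≥ n₀` light positions;
* `exists_adm_not_mem_union` — the probabilistic method for `phaseABad ∪ E` with an arbitrary
  extra event `E`: if the four bounds plus the weight of `E` sum to `< 1`, an admissible
  `r ∉ phaseABad ∪ E` exists.
-/

namespace Summit.ValiantsHypothesis.ValiantsHypothesis.Theorems.DefinabilityGapPhaseABad

open Finset Real Literature.Probability.Moments
open Literature.Computability.AlgebraicComplexity Literature.Computability.MetaComplexity
open Summit.ValiantsHypothesis.ValiantsHypothesis.Theorems.DefinabilityGapAffineRung
open Summit.ValiantsHypothesis.ValiantsHypothesis.Theorems.DefinabilityGapPivotCertificate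
open Summit.ValiantsHypothesis.ValiantsHypothesis.Theorems.DefinabilityGapPivotLive
open Summit.ValiantsHypothesis.ValiantsHypothesis.Theorems.DefinabilityGapPivotLiveWeak
open Summit.ValiantsHypothesis.ValiantsHypothesis.Theorems.DefinabilityGapPivotLiveBad
open Summit.ValiantsHypothesis.ValiantsHypothesis.Theorems.DefinabilityGapPivotAdmissible
open Summit.ValiantsHypothesis.ValiantsHypothesis.Theorems.DefinabilityGapPivotPhaseA
open Summit.ValiantsHypothesis.ValiantsHypothesis.Theorems.DefinabilityGapPivotGoodLines
open Summit.ValiantsHypothesis.ValiantsHypothesis.Theorems.DefinabilityGapPivotCrowded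
open Summit.ValiantsHypothesis.ValiantsHypothesis.Theorems.DefinabilityGapPivotGoodUnion
open Summit.ValiantsHypothesis.ValiantsHypothesis.Theorems.DefinabilityGapCrowdedFree
open Summit.ValiantsHypothesis.ValiantsHypothesis.Theorems.DefinabilityGapCrowdedUnion
open Summit.ValiantsHypothesis.ValiantsHypothesis.Theorems.DefinabilityGapPhaseAExists

variable {m : ℕ}

/-- The Phase-A bad set: row over-load ∪ column over-load ∪ few free columns ∪ few free rows.
[this file] -/
noncomputable def phaseABad (T : Finset (Fin 3 → Fin (qOf m))) (M N n₀ : ℕ) (p t B : ℝ) :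
    Finset ((Fin 3 → Fin (qOf m)) → Fin m) := by
  classical
  exact
    (((Finset.univ.filter fun r => ∃ c ∈ T, ∃ i : Fin m, p * ((m : ℝ) * M) + t ≤
        ∑ c', rowKillOn (lightCols T c M i) T c i c' (r c')) ∪
      (Finset.univ.filter fun r => ∃ c ∈ T, ∃ j : Fin m, p * ((m : ℝ) * M) + t ≤
        ∑ c', colKillOn (lightRows T c M j) T c j c' (r c'))) ∪
      (Finset.univ.filter fun r => ∃ c ∈ T, ∃ i : Fin m, n₀ ≤ (lightCols T c N i).card ∧
        ((freeCols T c r i).card : ℝ) < B)) ∪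
      (Finset.univ.filter fun r => ∃ c ∈ T, ∃ j : Fin m, n₀ ≤ (lightRows T c N j).card ∧
        ((freeRows T c r j).card : ℝ) < B)

open scoped Classical in
/-- **Weight of the Phase-A bad set** under any product weight with marginals `≤ p ≤ 1/2`:
at most the sum of the four union bounds. [this file] -/
theorem weight_phaseABad_le {w : (Fin 3 → Fin (qOf m)) → Fin m → ℝ}
    (hw : ∀ c a, 0 ≤ w c a) (hw1 : ∀ c, ∑ a, w c a = 1) {p : ℝ} (hp0 : 0 < p)
    (hp : p ≤ 1 / 2) (hwp : ∀ c a, w c a ≤ p) (T : Finset (Fin 3 → Fin (qOf m))) {M : ℕ}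
    (hM : 0 < M) (hm : 0 < m) {t : ℝ} (ht : 0 < t) {N : ℕ} (hN : 0 < N) {s n₀ : ℕ}
    (hs : 2 ≤ s) (hsn : s ≤ n₀) {t' B : ℝ} (ht' : 0 < t')
    (hB : B ≤ exp (-(2 * p * N)) * s / 2 - 2 * (4 * p * N * (s : ℝ) ^ 2 / n₀ + t')) :
    ∑ r ∈ phaseABad T M N n₀ p t B, prodWeight w r ≤
      (T.card : ℝ) * m * exp (-(t ^ 2 / (2 * (2 * (p * ((m : ℝ) * M)) + 2 * t / 3))))
      + (T.card : ℝ) * m * exp (-(t ^ 2 / (2 * (p * ((m : ℝ) * M) + 1 * t / 3))))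
      + 2 * ((T.card : ℝ) * m * (exp (-(exp (-(2 * p * N)) * s / 8)) +
          exp (-(t' ^ 2 / (2 * (4 * p * N * (s : ℝ) ^ 2 / n₀ + 1 * t' / 3)))))) := by
  have hwp' : ∀ c', w c' ≤ fun _ => p := fun c' a => hwp c' a
  have hR := weight_exists_rowOver_le hw hw1 hp0 hwp' T hM hm ht
  have hC := weight_exists_colOver_le hw hw1 hp0 hwp' T hM hm ht
  have hF := weight_exists_fewFreeCols_le hw hw1 hp0 hp hwp T hN hs hsn ht' hB
  have hG := weight_exists_fewFreeRows_le hw hw1 hp0 hp hwp T hN hs hsn ht' hB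
  have hnn : ∀ r, 0 ≤ prodWeight w r := prodWeight_nonneg hw
  unfold phaseABad
  have h1 := weight_union_le
    (((Finset.univ.filter fun r => ∃ c ∈ T, ∃ i : Fin m, p * ((m : ℝ) * M) + t ≤
        ∑ c', rowKillOn (lightCols T c M i) T c i c' (r c')) ∪
      (Finset.univ.filter fun r => ∃ c ∈ T, ∃ j : Fin m, p * ((m : ℝ) * M) + t ≤
        ∑ c', colKillOn (lightRows T c M j) T c j c' (r c'))) ∪
      (Finset.univ.filter fun r => ∃ c ∈ T, ∃ i : Fin m, n₀ ≤ (lightCols T c N i).card ∧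
        ((freeCols T c r i).card : ℝ) < B))
    (Finset.univ.filter fun r : (Fin 3 → Fin (qOf m)) → Fin m =>
      ∃ c ∈ T, ∃ j : Fin m, n₀ ≤ (lightRows T c N j).card ∧
        ((freeRows T c r j).card : ℝ) < B) hnn
  have h2 := weight_union_le
    ((Finset.univ.filter fun r => ∃ c ∈ T, ∃ i : Fin m, p * ((m : ℝ) * M) + t ≤
        ∑ c', rowKillOn (lightCols T c M i) T c i c' (r c')) ∪
      (Finset.univ.filter fun r => ∃ c ∈ T, ∃ j : Fin m, p * ((m : ℝ) * M) + t ≤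
        ∑ c', colKillOn (lightRows T c M j) T c j c' (r c')))
    (Finset.univ.filter fun r : (Fin 3 → Fin (qOf m)) → Fin m =>
      ∃ c ∈ T, ∃ i : Fin m, n₀ ≤ (lightCols T c N i).card ∧
        ((freeCols T c r i).card : ℝ) < B) hnn
  have h3 := weight_union_le
    (Finset.univ.filter fun r : (Fin 3 → Fin (qOf m)) → Fin m =>
      ∃ c ∈ T, ∃ i : Fin m, p * ((m : ℝ) * M) + t ≤
        ∑ c', rowKillOn (lightCols T c M i) T c i c' (r c'))
    (Finset.univ.filter fun r : (Fin 3 → Fin (qOf m)) → Fin m =>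
      ∃ c ∈ T, ∃ j : Fin m, p * ((m : ℝ) * M) + t ≤
        ∑ c', colKillOn (lightRows T c M j) T c j c' (r c')) hnn
  linarith

open scoped Classical in
/-- **Deterministic read-off.**  Off the Phase-A bad set and within the budget
`2 (L + pmM + t) ≤ m`: few bad rows and columns in every minor for every pivot column, and `B`
free columns (rows) on every row (column) with at least `n₀` light positions. [this file] -/
theorem phaseA_of_not_mem (T : Finset (Fin 3 → Fin (qOf m))) {M N n₀ L : ℕ} {p t B : ℝ}
    (hbudget : 2 * ((L : ℝ) + (p * ((m : ℝ) * M) + t)) ≤ m)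
    {r : (Fin 3 → Fin (qOf m)) → Fin m} (hr : r ∉ phaseABad T M N n₀ p t B) :
    (∀ s₀ : Fin m, ∀ c ∈ T,
        M * L * (badRows (pivotZeros m T s₀ r) c (r c) s₀).card ≤ 2 * (T.erase c).card ∧
        M * L * (badCols (pivotZeros m T s₀ r) c (r c) s₀).card ≤ 2 * (T.erase c).card) ∧
      (∀ c ∈ T, ∀ i : Fin m, n₀ ≤ (lightCols T c N i).card →
        B ≤ ((freeCols T c r i).card : ℝ)) ∧
      (∀ c ∈ T, ∀ j : Fin m, n₀ ≤ (lightRows T c N j).card →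
        B ≤ ((freeRows T c r j).card : ℝ)) := by
  unfold phaseABad at hr
  simp only [Finset.mem_union, Finset.mem_filter, Finset.mem_univ, true_and, not_or] at hr
  obtain ⟨⟨⟨hR, hC⟩, hF⟩, hG⟩ := hr
  have hrR : ∀ c ∈ T, ∀ i : Fin m,
      ∑ c', rowKillOn (lightCols T c M i) T c i c' (r c') < p * ((m : ℝ) * M) + t := by
    intro c hc i
    by_contra hge
    exact hR ⟨c, hc, i, not_lt.mp hge⟩
  have hrC : ∀ c ∈ T, ∀ j : Fin m,
      ∑ c', colKillOn (lightRows T c M j) T c j c' (r c') < p * ((m : ℝ) * M) + t := by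
    intro c hc j
    by_contra hge
    exact hC ⟨c, hc, j, not_lt.mp hge⟩
  refine ⟨fun s₀ c hc => ⟨mul_card_badRows_le_of_not_over T s₀ r M L hrR hbudget hc,
    mul_card_badCols_le_of_not_over T s₀ r M L hrC hbudget hc⟩, ?_, ?_⟩
  · intro c hc i hi
    by_contra hlt
    exact hF ⟨c, hc, i, hi, not_le.mp hlt⟩
  · intro c hc j hj
    by_contra hlt
    exact hG ⟨c, hc, j, hj, not_le.mp hlt⟩

open scoped Classical in
/-- **Phase A with an extra event.**  For admissible sets `A c` (nonempty, `1/#A c ≤ p ≤ 1/2`)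
and ANY further event `E`: if the four union bounds plus the weight of `E` sum to `< 1`, some
admissible `r` avoids `phaseABad … ∪ E`. [this file] -/
theorem exists_adm_not_mem_union (T : Finset (Fin 3 → Fin (qOf m)))
    (A : (Fin 3 → Fin (qOf m)) → Finset (Fin m)) (hA : ∀ c, (A c).Nonempty) {p : ℝ}
    (hp0 : 0 < p) (hp : p ≤ 1 / 2) (hAp : ∀ c, 1 / ((A c).card : ℝ) ≤ p) {M : ℕ}
    (hM : 0 < M) (hm : 0 < m) {t : ℝ} (ht : 0 < t) {N : ℕ} (hN : 0 < N) {s n₀ : ℕ}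
    (hs : 2 ≤ s) (hsn : s ≤ n₀) {t' B : ℝ} (ht' : 0 < t')
    (hB : B ≤ exp (-(2 * p * N)) * s / 2 - 2 * (4 * p * N * (s : ℝ) ^ 2 / n₀ + t'))
    (E : Finset ((Fin 3 → Fin (qOf m)) → Fin m))
    (hsmall : (T.card : ℝ) * m * exp (-(t ^ 2 / (2 * (2 * (p * ((m : ℝ) * M)) + 2 * t / 3))))
      + (T.card : ℝ) * m * exp (-(t ^ 2 / (2 * (p * ((m : ℝ) * M) + 1 * t / 3))))
      + 2 * ((T.card : ℝ) * m * (exp (-(exp (-(2 * p * N)) * s / 8)) +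
          exp (-(t' ^ 2 / (2 * (4 * p * N * (s : ℝ) ^ 2 / n₀ + 1 * t' / 3))))))
      + ∑ r ∈ E, prodWeight (admWeight A) r < 1) :
    ∃ r : (Fin 3 → Fin (qOf m)) → Fin m, r ∉ phaseABad T M N n₀ p t B ∧ r ∉ E ∧
      ∀ c, r c ∈ A c := by
  have hw : ∀ c a, 0 ≤ admWeight A c a := admWeight_nonneg A
  have hw1 : ∀ c, ∑ a, admWeight A c a = 1 := sum_admWeight A hA
  have hwp : ∀ c a, admWeight A c a ≤ p := fun c a => (admWeight_le A c a).trans (hAp c)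
  have hbad := weight_phaseABad_le hw hw1 hp0 hp hwp T hM hm ht hN hs hsn ht' hB
  have hU := weight_union_le (phaseABad T M N n₀ p t B) E (prodWeight_nonneg hw)
  obtain ⟨r, hr, hadm⟩ := exists_adm_not_mem A hA (phaseABad T M N n₀ p t B ∪ E)
    (by linarith)
  exact ⟨r, fun h => hr (Finset.mem_union_left _ h), fun h => hr (Finset.mem_union_right _ h),
    hadm⟩

end Summit.ValiantsHypothesis.ValiantsHypothesis.Theorems.DefinabilityGapPhaseABad
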